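import Summits.Ventures.PercRepro.ProfilePointedCircuitClassesPairSevenC

/-!
# PercRepro — THE q = 7 ROW AT `n = 14` HINGES ON ONE TWELVE-POINT STATEMENT (p5, gen 42; `proofs/P5-GM1.md` §64
ADDENDUM 1)

On a matroid with `#E = 14` and rank `8` (nullity `6`) the minors `N ／ x ∖ w` of the per-circuit reduction have
`12` points and rank `7`, so the class `#C = 3` is UNCONDITIONAL by the per-pair theorem at `n = 12`
(`gammaC_six_le_of_card_eq_three_of_fourteen`), and the whole row needs only the per-point inequality at `n = 12`:
`InOutBottomTwelve` := `in_5(e) ≤ out_6(e)` on every matroid with `#E = 12`, `ρ(E) = 7` (a `Prop`, NOT asserted —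
the `n = 12` instance of `InOutBottomFive`, §62(1): 0 failures on 56,572 twin-free points).  Consequences modulo
it: Theorem A's step `8·P_6 ≤ 7·P_7` on every matroid with `14` points and rank `8`
(`biIndep_step_six_of_fourteen_of_inout`) and the co-rank-7 top threshold `(I_7)` there
(`thresholdIneq_seven_top_of_fourteen_of_inout`).
-/

open scoped Matroid

namespace PercRepro.Cogirth

open Finset ThmH Skew Shadow Profile

variable {α : Type} [DecidableEq α] {N : Matroid α} [N.Finite]

section SixFourteen

/-- **THE PER-POINT IN–OUT INEQUALITY AT `n = 12`** (a `Prop`; a CONJECTURE, NOT asserted): on every finite matroid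
with `12` points and rank `7`, at every point `e`, `in_5(e) ≤ out_6(e)` — the `n = 12` instance of
`InOutBottomFive` (§62(1): 0 failures on 56,572 twin-free points; §63(d): no certificate of the §61 shape). -/
def InOutBottomTwelve (α : Type) [DecidableEq α] : Prop :=
  ∀ (N : Matroid α) [N.Finite] (e : α), e ∈ gr N → (gr N).card = 12 → rk N (gr N) = 7 →
    inCount N 5 e ≤ outCount N 6 e

/-- `InOutBottomFive` implies its `n = 12` instance. -/
theorem inOutBottomTwelve_of_inOutBottomFive (h : InOutBottomFive α) : InOutBottomTwelve α := by
  intro N _ e he hn hR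
  exact h N e he (by omega) (by omega)

/-- THE CLASS `#C = 3` AT `n = 14`, RANK `8`, UNCONDITIONAL: the minor `N ／ x ∖ w` has `12` points and rank `7`,
where the per-pair inequality is the theorem `thruCount_five_le_thruCount_six_of_card_eq_twelve`. -/
theorem gammaC_six_le_of_card_eq_three_of_fourteen (hn : (gr N).card = 14) (hR : rk N (gr N) = 8)
    (x : α) {C : Finset α} (hC : C.card = 3) : gammaC N 6 x C ≤ gammaC N ((gr N).card - 7) x C := by
  rcases ((biIndepSets N 6).filter (fun W => x ∉ W ∧ x ∈ clF N W ∧ fundC N W x = C)).eq_empty_or_nonempty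
    with hemp | ⟨W₀, hW₀⟩
  · unfold gammaC
    rw [hemp, card_empty]
    exact Nat.zero_le _
  obtain ⟨-, hCg, hxg, hxC, hrk, hxcl, hfund, hx1⟩ := circuit_facts_of_mem_class hW₀
  obtain ⟨w, hw⟩ : C.Nonempty := card_pos.1 (by omega)
  obtain ⟨hgr₀, hcard₀, hrkg₀⟩ := minor_facts_of_circuit hCg hxg hxC hrk hxcl hfund hx1 hw
  have e : (gr N).card - 7 = (gr N).card - 1 - 6 := by omega
  rw [e, gammaC_le_iff_thruCount_le hCg hxg hxC hrk hxcl hfund hw (by norm_num) (by omega)]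
  have hSg : C.erase w ⊆ gr ((N ／ ({x} : Set α)) ＼ ({w} : Set α)) := by
    rw [hgr₀]
    intro a ha
    rw [mem_erase] at ha
    exact mem_erase.2 ⟨ha.1, mem_erase.2 ⟨fun h => hxC (h ▸ ha.2), hCg ha.2⟩⟩
  have hScard : (C.erase w).card = 2 := by rw [card_erase_of_mem hw, hC]
  have hn₀ : (gr ((N ／ ({x} : Set α)) ＼ ({w} : Set α))).card = 12 := by rw [hcard₀, hn]
  have hR₀ : rk ((N ／ ({x} : Set α)) ＼ ({w} : Set α)) (gr ((N ／ ({x} : Set α)) ＼ ({w} : Set α))) = 7 := by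
    rw [hrkg₀, hR]
  have h := thruCount_five_le_thruCount_six_of_card_eq_twelve hn₀ hR₀ hSg hScard
  rw [hcard₀] at h
  have e1 : (6 : ℕ) - 1 = 5 := by norm_num
  rw [e1]
  exact h

/-- THE CLASS `#C = 2` AT `n = 14`, RANK `8`, MODULO `InOutBottomTwelve`: the triangle bridge with `in_5(w₂) ≤ out_6(w₂)`
on the `12`-point minor. -/
theorem gammaC_six_le_of_card_eq_two_of_fourteen (hio : InOutBottomTwelve α) (hn : (gr N).card = 14)
    (hR : rk N (gr N) = 8) (x : α) {C : Finset α} (hC : C.card = 2) :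
    gammaC N 6 x C ≤ gammaC N ((gr N).card - 7) x C := by
  obtain ⟨w₁, w₂, hw12, rfl⟩ := card_eq_two.1 hC
  rcases ((biIndepSets N 6).filter (fun W => x ∉ W ∧ x ∈ clF N W ∧ fundC N W x = {w₁, w₂})).eq_empty_or_nonempty
    with hemp | ⟨W₀, hW₀⟩
  · unfold gammaC
    rw [hemp, card_empty]
    exact Nat.zero_le _
  obtain ⟨-, hCg, hxg, hxC, hrk, hxcl, hfund, hx1⟩ := circuit_facts_of_mem_class hW₀
  have hw₂g : w₂ ∈ gr N := hCg (mem_insert_of_mem (mem_singleton_self _))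
  have hxw₂ : x ≠ w₂ := fun h => hxC (h ▸ mem_insert_of_mem (mem_singleton_self _))
  have hrk2 : rk N {w₁, w₂} = 2 := by rw [hrk, card_pair hw12]
  have hxn2 : x ∉ clF N {w₂} := by
    have h := hfund w₁ (mem_insert_self _ _)
    have e : ({w₁, w₂} : Finset α).erase w₁ = {w₂} := by
      rw [erase_insert]
      rw [mem_singleton]; exact hw12
    rwa [e] at h
  have hxn1 : x ∉ clF N {w₁} := by
    have h := hfund w₂ (mem_insert_of_mem (mem_singleton_self _))
    have e : ({w₁, w₂} : Finset α).erase w₂ = {w₁} := by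
      rw [erase_insert_of_ne hw12, erase_singleton, insert_empty]
    rwa [e] at h
  obtain ⟨hgr₀, hcard₀, hrkg₀⟩ :=
    minor_facts_of_circuit hCg hxg hxC hrk hxcl hfund hx1 (mem_insert_self w₁ {w₂})
  have e : (gr N).card - 7 = (gr N).card - 1 - 6 := by omega
  rw [e]
  apply gammaC_le_of_card_eq_two_of_inout' hw12 hCg hxg hxC hrk2 hxcl hxn2 hxn1 (by norm_num) (by omega)
  have hw₂g₀ : w₂ ∈ gr ((N ／ ({x} : Set α)) ＼ ({w₁} : Set α)) := by
    rw [hgr₀]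
    exact mem_erase.2 ⟨hw12.symm, mem_erase.2 ⟨fun h => hxw₂ h.symm, hw₂g⟩⟩
  have hn₀ : (gr ((N ／ ({x} : Set α)) ＼ ({w₁} : Set α))).card = 12 := by rw [hcard₀, hn]
  have hR₀ : rk ((N ／ ({x} : Set α)) ＼ ({w₁} : Set α)) (gr ((N ／ ({x} : Set α)) ＼ ({w₁} : Set α))) = 7 := by
    rw [hrkg₀, hR]
  have e1 : (6 : ℕ) - 1 = 5 := by norm_num
  rw [e1]
  exact hio _ w₂ hw₂g₀ hn₀ hR₀

/-- **THE BOTTOM-LEVEL PER-CIRCUIT CLAIM AT `n = 14`, RANK `8`, MODULO `InOutBottomTwelve`** (the `#C = 3` class is now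
unconditional). -/
theorem gammaC_six_le_of_fourteen_of_inout (hio : InOutBottomTwelve α) (hn : (gr N).card = 14)
    (hR : rk N (gr N) = 8) (x : α) (C : Finset α) : gammaC N 6 x C ≤ gammaC N ((gr N).card - 7) x C := by
  have hn' : (gr N).card = rk N (gr N) + 6 := by omega
  rcases Nat.lt_or_ge 6 C.card with h7 | h6
  · rw [gammaC_eq_zero_of_lt_card h7]
    exact Nat.zero_le _
  · by_cases hx : x ∈ gr N
    · interval_cases hc : C.card
      · rw [gammaC_eq_zero_of_card_eq_zero hc (by norm_num) hx]
        exact Nat.zero_le _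
      · exact gammaC_six_le_of_card_eq_one hn' (by omega) x hc
      · exact gammaC_six_le_of_card_eq_two_of_fourteen hio hn hR x hc
      · exact gammaC_six_le_of_card_eq_three_of_fourteen hn hR x hc
      · have h := gammaC_le_of_card_eq_nullity_sub_two (ν := 6) (by norm_num) hn' (by omega) x (by rw [hc])
        simpa using h
      · have h := gammaC_le_of_card_eq_nullity_sub_one (ν := 6) hn' (by omega) x (by norm_num) (by rw [hc])
        simpa using h
      · have h := gammaC_le_of_card_eq_nullity (ν := 6) hn' (by omega) x (by rw [hc])
        simpa using h
    · have h0 : gammaC N 6 x C = 0 := by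
        unfold gammaC
        rw [card_eq_zero, filter_eq_empty_iff]
        intro W _ hWC
        exact hx (clF_subset_gr W hWC.2.1)
      rw [h0]
      exact Nat.zero_le _

/-- **THEOREM A'S STEP AT THE LEVEL `6` ON EVERY MATROID WITH `14` POINTS AND RANK `8`, MODULO `InOutBottomTwelve`**:
`8·P_6 ≤ 7·P_7`. -/
theorem biIndep_step_six_of_fourteen_of_inout (hio : InOutBottomTwelve α) (hn : (gr N).card = 14)
    (hR : rk N (gr N) = 8) : ((gr N).card - 6) * (biIndepSets N 6).card ≤ 7 * (biIndepSets N 7).card := by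
  rw [← sum_outCount, ← sum_inCount]
  apply sum_le_sum
  intro x hx
  have h := outCount_add_capCount_mirror (M := N) 6 hx (by omega)
  have h2 : capCount N 6 x ≤ capCount N ((gr N).card - 7) x := by
    rw [capCount_eq_sum_gammaC, capCount_eq_sum_gammaC]
    exact sum_le_sum (fun C _ => gammaC_six_le_of_fourteen_of_inout hio hn hR x C)
  norm_num at h
  omega

/-- **THE CO-RANK-7 TOP THRESHOLD ON EVERY MATROID WITH `14` POINTS AND RANK `8`, MODULO THE PER-POINT IN–OUT
INEQUALITY AT `n = 12`** — the first row of `q = 7` beyond the trivial ones hinges on a single twelve-point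
statement. -/
theorem thresholdIneq_seven_top_of_fourteen_of_inout (hio : InOutBottomTwelve α) (hn : (gr N).card = 14)
    (hR : rk N (gr N) = 8) : ThresholdIneq N 7 (rk N (gr N) - 1) := by
  have hn' : (gr N).card = (rk N (gr N) - 1) + 7 := by omega
  unfold ThresholdIneq
  rw [thresholdSum_of_card_eq hn' (by norm_num), levelSetCoQ_eq_biIndepSets_of_card_eq hn']
  have h := biIndep_step_six_of_fourteen_of_inout hio hn hR
  have e1 : (gr N).card - 6 = (rk N (gr N) - 1) + 1 := by omega
  rw [e1] at h
  exact h

end SixFourteen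

end PercRepro.Cogirth
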